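import Summits.AtomisticToContinuum.FouriersLaw.Theorems.BondHeatUncertaintyExtensiveSnapshotIrreversibilityEnergyWindowKrylovCurve
import HarnessLib

/-!
# Bond–heat uncertainty window, part U-a2: the short-time sampling rate of a linear output

Cell `decomp-a2c`, lineage crux `ExtensiveSnapshotIrreversibility` (K_fix half, leaf S3
`KernelTemperatureLipschitz`), HARMONIC CALIBRATION of the skeleton-weight leaf (SWM)
`SkeletonWeightMoments` (part R).

**Theorem (`sq_output_le_div_mul_integral`).** Let `E` be a finite-dimensional real normed space,
`M : E →L[ℝ] E` and `C : E →L[ℝ] ℝ` ANY bounded operator and output functional. There is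
`K > 0` such that for all `s ∈ (0, 1]` and all `X : E`
`(C X)² ≤ (K / s) · ∫₀ˢ (C exp(tM) X)² dt`,
and (`sq_output_end_le_div_mul_integral`) the same with `C exp(sM) X` on the left. No
observability is needed: the output `t ↦ C exp(tM) X` is a quasi-polynomial from a fixed
`finrank E`-dimensional space; in the graded Krylov coordinates of part U-a1 Grönwall puts `Z`
within `O(s)‖Z(0)‖` of the shift flow, the shift is observable from its first coordinate, and
`|Z(0)| ≥ |Z_0(0)| = |C X|`.

References: E. D. Sontag, *Mathematical Control Theory* (1998), §6.2; F. L. Nazarov, *Local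
estimates for exponential polynomials*, Algebra i Analiz 5 (1993) (the quantitative version, not
needed here). [folklore]
-/

noncomputable section

namespace Summit.AtomisticToContinuum.FouriersLaw.Theorems.ExtensiveSnapshotIrreversibility.EnergyWindow

open MeasureTheory Set Filter Topology NormedSpace Finset
open Literature.Analysis.ODE

section Rate

variable {E : Type*} [NormedAddCommGroup E] [NormedSpace ℝ E] [CompleteSpace E]
  [FiniteDimensional ℝ E] (M : E →L[ℝ] E) (C : E →L[ℝ] ℝ)

/-! ## 4. The sampling rate -/

/-- **Short-time sampling rate of a linear output (initial value).** For ANY `M`, `C` on a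
finite-dimensional space: `(C X)² ≤ (K/s) ∫₀ˢ (C exp(tM) X)² dt` for `s ∈ (0, 1]`. [folklore] -/
theorem sq_output_le_div_mul_integral :
    ∃ K : ℝ, 0 < K ∧ ∀ s : ℝ, 0 < s → s ≤ 1 → ∀ X : E,
      (C X) ^ 2 ≤ K / s * ∫ t in (0 : ℝ)..s, (C (exp (t • M) X)) ^ 2 := by
  rcases subsingleton_or_nontrivial E with hE | hE
  · refine ⟨1, one_pos, fun s hs _ X => ?_⟩
    rw [Subsingleton.elim X 0, map_zero, sq, mul_zero]
    exact mul_nonneg (by positivity) (observationEnergy_nonneg M C hs.le 0)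
  have hn : 0 < Module.finrank ℝ E := Module.finrank_pos
  obtain ⟨c, hc, hobs⟩ := exists_shift_observabilityConstant (Module.finrank ℝ E) hn
  -- constants
  obtain ⟨α, hα⟩ : ∃ α : ℝ, α = ∑ i : Fin (Module.finrank ℝ E), |charCoeff M i| := ⟨_, rfl⟩
  have hα0 : 0 ≤ α := by rw [hα]; exact Finset.sum_nonneg fun i _ => abs_nonneg _
  obtain ⟨nS, hnS⟩ : ∃ nS : ℝ, nS = ‖shiftCLM (Module.finrank ℝ E)‖ := ⟨_, rfl⟩
  have hnS0 : 0 ≤ nS := by rw [hnS]; exact norm_nonneg _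
  obtain ⟨K₁, hK₁⟩ : ∃ K₁ : ℝ, K₁ = nS + α := ⟨_, rfl⟩
  have hK₁0 : 0 ≤ K₁ := by rw [hK₁]; exact add_nonneg hnS0 hα0
  obtain ⟨C₁, hC₁⟩ : ∃ C₁ : ℝ, C₁ = α * Real.exp K₁ * Real.exp nS := ⟨_, rfl⟩
  have hC₁0 : 0 ≤ C₁ := by
    rw [hC₁]; exact mul_nonneg (mul_nonneg hα0 (Real.exp_pos _).le) (Real.exp_pos _).le
  obtain ⟨s₀, hs₀⟩ : ∃ s₀ : ℝ, s₀ = min 1 (Real.sqrt c / (2 * (C₁ + 1))) := ⟨_, rfl⟩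
  have hs₀pos : 0 < s₀ := by
    rw [hs₀]; exact lt_min one_pos (div_pos (Real.sqrt_pos.2 hc) (by linarith))
  have hs₀1 : s₀ ≤ 1 := by rw [hs₀]; exact min_le_left _ _
  -- the small-`s` claim
  have hsmall : ∀ s : ℝ, 0 < s → s ≤ s₀ → ∀ X : E,
      (C X) ^ 2 ≤ 4 / (c * s) * ∫ t in (0 : ℝ)..s, (C (exp (t • M) X)) ^ 2 := by
    intro s hs hss X
    have hs1 : s ≤ 1 := hss.trans hs₀1
    have hZc : Continuous (krylovCurve M C s X) := continuous_krylovCurve M C s X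
    have hZ0 : 0 ≤ ‖krylovCurve M C s X 0‖ := norm_nonneg _
    -- generator norms
    have hL : ‖lastRowCLM (Module.finrank ℝ E) (krylovWeights M s)‖ ≤ s * α := by
      rw [hα]; exact norm_lastRow_krylovWeights_le M hs.le hs1
    have hsα : s * α ≤ α := mul_le_of_le_one_left hα0 hs1
    have hG : ‖krylovGen M s‖ ≤ K₁ := by
      rw [hK₁, hnS]
      exact (norm_add_le _ _).trans (by linarith)
    -- a priori bound (Grönwall against the zero solution)
    have hsol : IsIntegralSolutionOn (krylovGen M s) (fun _ => krylovCurve M C s X 0)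
        (krylovCurve M C s X) 1 := fun t _ => krylovCurve_eq_add_integral M C s X t
    have hzero : IsIntegralSolutionOn (krylovGen M s)
        (fun _ => (0 : Fin (Module.finrank ℝ E) → ℝ)) (fun _ => 0) 1 := by
      intro t _; simp
    have hapr : ∀ t ∈ Icc (0 : ℝ) 1,
        ‖krylovCurve M C s X t‖ ≤ ‖krylovCurve M C s X 0‖ * Real.exp K₁ := by
      intro t ht
      have h := IsIntegralSolutionOn.norm_sub_le_mul_exp (S := univ)
        (δ := ‖krylovCurve M C s X 0‖)
        (krylovGen M s).lipschitz.lipschitzOnWith hsol hzero hZc continuous_const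
        (fun _ _ => mem_univ _) (fun _ _ => mem_univ _) (fun t _ => by rw [sub_zero]) t ht
      rw [sub_zero] at h
      refine h.trans (mul_le_mul_of_nonneg_left (Real.exp_le_exp.2 ?_) hZ0)
      calc (‖krylovGen M s‖₊ : ℝ) * t ≤ K₁ * 1 :=
            mul_le_mul (by simpa using hG) ht.2 ht.1 hK₁0
        _ = K₁ := mul_one _
    -- the perturbed shift equation
    have hsolS : IsIntegralSolutionOn (shiftCLM (Module.finrank ℝ E))
        (fun t => krylovCurve M C s X 0 + ∫ u in (0 : ℝ)..t,
          lastRowCLM (Module.finrank ℝ E) (krylovWeights M s) (krylovCurve M C s X u))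
        (krylovCurve M C s X) 1 := by
      intro t ht
      have hiS : IntervalIntegrable (fun u => shiftCLM (Module.finrank ℝ E)
          (krylovCurve M C s X u)) volume 0 t :=
        ((shiftCLM _).continuous.comp hZc).intervalIntegrable _ _
      have hiL : IntervalIntegrable (fun u => lastRowCLM (Module.finrank ℝ E)
          (krylovWeights M s) (krylovCurve M C s X u)) volume 0 t :=
        ((lastRowCLM _ _).continuous.comp hZc).intervalIntegrable _ _
      rw [hsol t ht, add_assoc, ← intervalIntegral.integral_add hiL hiS]
      congr 1
      refine intervalIntegral.integral_congr fun u _ => ?_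
      simp only [krylovGen, FunLike.coe_add, Pi.add_apply]
      exact add_comm _ _
    -- deviation of the forcing from the constant `Z 0`
    have hdev : ∀ t ∈ Icc (0 : ℝ) 1,
        ‖(krylovCurve M C s X 0 + ∫ u in (0 : ℝ)..t,
          lastRowCLM (Module.finrank ℝ E) (krylovWeights M s) (krylovCurve M C s X u)) -
          krylovCurve M C s X 0‖ ≤ s * α * (‖krylovCurve M C s X 0‖ * Real.exp K₁) := by
      intro t ht
      rw [add_sub_cancel_left]
      have hb : ∀ u ∈ Set.uIoc (0 : ℝ) t, ‖lastRowCLM (Module.finrank ℝ E) (krylovWeights M s)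
          (krylovCurve M C s X u)‖ ≤ s * α * (‖krylovCurve M C s X 0‖ * Real.exp K₁) := by
        intro u hu
        rw [Set.uIoc_of_le ht.1] at hu
        have hu' : u ∈ Icc (0 : ℝ) 1 := ⟨hu.1.le, hu.2.trans ht.2⟩
        calc ‖lastRowCLM (Module.finrank ℝ E) (krylovWeights M s) (krylovCurve M C s X u)‖
            ≤ ‖lastRowCLM (Module.finrank ℝ E) (krylovWeights M s)‖ *
                ‖krylovCurve M C s X u‖ := ContinuousLinearMap.le_opNorm _ _
          _ ≤ (s * α) * (‖krylovCurve M C s X 0‖ * Real.exp K₁) :=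
              mul_le_mul hL (hapr u hu') (norm_nonneg _) (mul_nonneg hs.le hα0)
      refine (intervalIntegral.norm_integral_le_of_norm_le_const hb).trans ?_
      rw [sub_zero, abs_of_nonneg ht.1]
      exact mul_le_of_le_one_right (mul_nonneg (mul_nonneg hs.le hα0)
        (mul_nonneg hZ0 (Real.exp_pos _).le)) ht.2
    -- distance to the shift flow
    have hdist : ∀ t ∈ Icc (0 : ℝ) 1,
        ‖krylovCurve M C s X t - exp (t • shiftCLM (Module.finrank ℝ E))
          (krylovCurve M C s X 0)‖ ≤ C₁ * s * ‖krylovCurve M C s X 0‖ := by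
      intro t ht
      refine (IsIntegralSolutionOn.norm_sub_linearFlow_le hsolS hZc hdev t ht).trans ?_
      rw [← hnS]
      have he : Real.exp (nS * t) ≤ Real.exp nS :=
        Real.exp_le_exp.2 (by nlinarith [ht.1, ht.2])
      calc s * α * (‖krylovCurve M C s X 0‖ * Real.exp K₁) * Real.exp (nS * t)
          ≤ s * α * (‖krylovCurve M C s X 0‖ * Real.exp K₁) * Real.exp nS :=
            mul_le_mul_of_nonneg_left he (mul_nonneg (mul_nonneg hs.le hα0)
              (mul_nonneg hZ0 (Real.exp_pos _).le))
        _ = C₁ * s * ‖krylovCurve M C s X 0‖ := by rw [hC₁]; ring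
    -- the two first coordinates
    have hya : ∀ t ∈ Icc (0 : ℝ) 1,
        |krylovCurve M C s X t ⟨0, hn⟩ -
          (exp (t • shiftCLM (Module.finrank ℝ E)) (krylovCurve M C s X 0)) ⟨0, hn⟩| ≤
          C₁ * s * ‖krylovCurve M C s X 0‖ := by
      intro t ht
      rw [← Real.norm_eq_abs, ← Pi.sub_apply]
      exact (norm_le_pi_norm _ _).trans (hdist t ht)
    have hint := integral_sq_ge_of_abs_sub_le zero_le_one
      (a := fun t => (exp (t • shiftCLM (Module.finrank ℝ E)) (krylovCurve M C s X 0)) ⟨0, hn⟩)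
      (y := fun t => krylovCurve M C s X t ⟨0, hn⟩)
      ((continuous_apply _).comp (continuous_linearFlow _ _)) ((continuous_apply _).comp hZc)
      hya
    have hobsZ := hobs (krylovCurve M C s X 0)
    -- smallness of `s`: `C₁² s² ≤ c / 4`
    have hsmallC : (C₁ * s) ^ 2 ≤ c / 4 := by
      have h1 : s ≤ Real.sqrt c / (2 * (C₁ + 1)) := by
        rw [hs₀] at hss; exact hss.trans (min_le_right _ _)
      have h2 : C₁ * s ≤ Real.sqrt c / 2 := by
        have h21 : C₁ * s ≤ C₁ * (Real.sqrt c / (2 * (C₁ + 1))) :=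
          mul_le_mul_of_nonneg_left h1 hC₁0
        have h22 : C₁ * (Real.sqrt c / (2 * (C₁ + 1))) ≤ Real.sqrt c / 2 := by
          rw [mul_div_assoc', div_le_div_iff₀ (by linarith) two_pos]
          nlinarith [Real.sqrt_nonneg c]
        exact h21.trans h22
      calc (C₁ * s) ^ 2 ≤ (Real.sqrt c / 2) ^ 2 :=
            pow_le_pow_left₀ (mul_nonneg hC₁0 hs.le) h2 2
        _ = c / 4 := by rw [div_pow, Real.sq_sqrt hc.le]; norm_num
    -- conclude on `[0, 1]`
    have hZ00 : (C X) ^ 2 ≤ ‖krylovCurve M C s X 0‖ ^ 2 := by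
      rw [← krylovCurve_apply_zero_zero M C hn s X, ← sq_abs]
      refine pow_le_pow_left₀ (abs_nonneg _) ?_ 2
      have := norm_le_pi_norm (krylovCurve M C s X 0) ⟨0, hn⟩
      rwa [Real.norm_eq_abs] at this
    have hI1 : c / 4 * (C X) ^ 2 ≤
        ∫ t in (0 : ℝ)..1, (krylovCurve M C s X t ⟨0, hn⟩) ^ 2 := by
      have h4 : (1 : ℝ) * (C₁ * s * ‖krylovCurve M C s X 0‖) ^ 2 ≤
          c / 4 * ‖krylovCurve M C s X 0‖ ^ 2 := by
        rw [one_mul, mul_pow]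
        exact mul_le_mul_of_nonneg_right hsmallC (sq_nonneg _)
      nlinarith [hint, hobsZ, h4, hZ00, hc]
    -- time rescaling `t ↦ s t`
    have hscale : ∫ t in (0 : ℝ)..s, (C (exp (t • M) X)) ^ 2 =
        s * ∫ t in (0 : ℝ)..1, (krylovCurve M C s X t ⟨0, hn⟩) ^ 2 := by
      have h := intervalIntegral.smul_integral_comp_mul_left
        (f := fun u => (C (exp (u • M) X)) ^ 2) (a := 0) (b := 1) s
      rw [mul_zero, mul_one, smul_eq_mul] at h
      rw [← h]
      congr 1
      refine intervalIntegral.integral_congr fun t _ => ?_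
      simp only [krylovCurve_zero_apply, smul_smul, mul_comm t s]
    rw [hscale]
    have hcs : 0 < c * s := mul_pos hc hs
    calc (C X) ^ 2 ≤ 4 / c * ∫ t in (0 : ℝ)..1, (krylovCurve M C s X t ⟨0, hn⟩) ^ 2 := by
          rw [div_mul_eq_mul_div, le_div_iff₀ hc]; linarith
      _ = 4 / (c * s) * (s * ∫ t in (0 : ℝ)..1, (krylovCurve M C s X t ⟨0, hn⟩) ^ 2) := by
          field_simp
  -- all `s ∈ (0, 1]`
  refine ⟨4 / (c * s₀), by positivity, fun s hs hs1 X => ?_⟩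
  have hI : 0 ≤ ∫ t in (0 : ℝ)..s, (C (exp (t • M) X)) ^ 2 := observationEnergy_nonneg M C hs.le X
  by_cases hss : s ≤ s₀
  · refine (hsmall s hs hss X).trans (mul_le_mul_of_nonneg_right ?_ hI)
    rw [div_div, div_le_div_iff₀ (by positivity) (by positivity)]
    nlinarith [mul_pos hc hs]
  · rw [not_le] at hss
    have h0 := hsmall s₀ hs₀pos le_rfl X
    have hmono : ∫ t in (0 : ℝ)..s₀, (C (exp (t • M) X)) ^ 2 ≤
        ∫ t in (0 : ℝ)..s, (C (exp (t • M) X)) ^ 2 :=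
      intervalIntegral.integral_mono_interval le_rfl hs₀pos.le hss.le
        (Eventually.of_forall fun t => sq_nonneg _)
        (((C.continuous.comp (continuous_linearFlow M X)).pow 2).intervalIntegrable _ _)
    have h1 : 4 / (c * s₀) ≤ 4 / (c * s₀) / s := by
      rw [le_div_iff₀ hs]; exact mul_le_of_le_one_right (by positivity) hs1
    calc (C X) ^ 2 ≤ 4 / (c * s₀) * ∫ t in (0 : ℝ)..s₀, (C (exp (t • M) X)) ^ 2 := h0
      _ ≤ 4 / (c * s₀) * ∫ t in (0 : ℝ)..s, (C (exp (t • M) X)) ^ 2 :=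
          mul_le_mul_of_nonneg_left hmono (by positivity)
      _ ≤ 4 / (c * s₀) / s * ∫ t in (0 : ℝ)..s, (C (exp (t • M) X)) ^ 2 :=
          mul_le_mul_of_nonneg_right h1 hI

/-- **Short-time sampling rate of a linear output (final value).** For ANY `M`, `C` on a
finite-dimensional space: `(C exp(sM) X)² ≤ (K/s) ∫₀ˢ (C exp(tM) X)² dt`, `s ∈ (0, 1]`
(the initial-value rate for `-M`, read backwards from `exp(sM) X`). [folklore] -/
theorem sq_output_end_le_div_mul_integral :
    ∃ K : ℝ, 0 < K ∧ ∀ s : ℝ, 0 < s → s ≤ 1 → ∀ X : E,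
      (C (exp (s • M) X)) ^ 2 ≤ K / s * ∫ t in (0 : ℝ)..s, (C (exp (t • M) X)) ^ 2 := by
  obtain ⟨K, hK, h⟩ := sq_output_le_div_mul_integral (-M) C
  refine ⟨K, hK, fun s hs hs1 X => ?_⟩
  have h1 := h s hs hs1 (exp (s • M) X)
  have h2 : ∀ t : ℝ, exp (t • (-M)) (exp (s • M) X) = exp ((s - t) • M) X := by
    intro t
    let _ : NormedAlgebra ℚ (E →L[ℝ] E) := .restrictScalars ℚ ℝ _
    have hcomm : Commute ((-t) • M) (s • M) := ((Commute.refl M).smul_left _).smul_right _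
    change (exp (t • (-M)) * exp (s • M)) X = _
    rw [smul_neg, ← neg_smul, ← exp_add_of_commute hcomm, ← add_smul,
      show -t + s = s - t by ring]
  have h3 : ∫ t in (0 : ℝ)..s, (C (exp (t • (-M)) (exp (s • M) X))) ^ 2 =
      ∫ t in (0 : ℝ)..s, (C (exp (t • M) X)) ^ 2 := by
    simp_rw [h2]
    have h4 := intervalIntegral.integral_comp_sub_left
      (fun u => (C (exp (u • M) X)) ^ 2) (a := 0) (b := s) s
    rw [sub_self, sub_zero] at h4
    exact h4
  rw [h3] at h1
  exact h1


end Rate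

end Summit.AtomisticToContinuum.FouriersLaw.Theorems.ExtensiveSnapshotIrreversibility.EnergyWindow
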